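import Mathlib.MeasureTheory.Function.ContinuousMapDense
import Mathlib.MeasureTheory.Integral.Bochner.Basic
import Mathlib.MeasureTheory.Integral.Bochner.Set
import Mathlib.MeasureTheory.Measure.Regular
import HarnessLib

/-!
# Extending integral bounds from continuous to bounded measurable test functions

Let `μ`, `ν` be finite Borel measures on a normal pseudo-metrizable space `X` and suppose that
`|∫ g dμ - ∫ g dν| ≤ C` for every *continuous* `g : X → ℝ` with `|g| ≤ 1`.  We prove:

* `abs_integral_sub_integral_le_of_forall_continuous`: the same bound holds for every
  *measurable* `φ` with `|φ| ≤ 1`;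
* `abs_integral_sub_integral_le_mul_of_forall_continuous`: the scaled form
  `|∫ φ dμ - ∫ φ dν| ≤ C * B` for measurable `φ` with `|φ| ≤ B`;
* `abs_measureReal_sub_measureReal_le_of_forall_continuous`: if moreover `μ univ = ν univ`
  then `|μ.real S - ν.real S| ≤ C / 2` for every measurable set `S`.

The proof is the standard density argument: bounded continuous functions are dense in
`L¹(μ + ν)` (Mathlib's `MeasureTheory.Integrable.exists_boundedContinuous_integral_sub_le`,
using that finite Borel measures on pseudo-metrizable spaces are weakly regular), and clipping
an approximant to `[-1, 1]` keeps it continuous, makes it an admissible test function, and does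
not increase its distance to `φ`.

These lemmas are the measure-theoretic step turning gradient/Lipschitz estimates for heat-kernel
integrals of continuous test functions into the corresponding statements for bounded measurable
integrands and for measures of sets, as required in the axioms of a metric flow
(Bamler 2023, Definition 3.2 (6)).

## References

* R. M. Dudley, *Real Analysis and Probability*, 2002, §7.1 (regularity of finite Borel
  measures on metric spaces) and §11.3.
* R. H. Bamler, *Compactness theory of the space of super Ricci flows*, Invent. Math. 2023,
  Definition 3.2.
-/

noncomputable section

open _root_.MeasureTheory _root_.MeasureTheory.Measure TopologicalSpace Filter Set
open scoped ENNReal NNReal Topology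

namespace Literature.MeasureTheory.Integral

variable {X : Type*} [TopologicalSpace X] [MeasurableSpace X] [BorelSpace X]

omit [TopologicalSpace X] [BorelSpace X] in
/-- A measurable real function bounded by `B` is integrable for every finite measure.
[folklore] -/
private lemma integrable_of_abs_le {φ : X → ℝ} (hφm : Measurable φ) {B : ℝ}
    (hφb : ∀ x, |φ x| ≤ B) (ρ : Measure X) [IsFiniteMeasure ρ] : Integrable φ ρ :=
  Integrable.of_bound hφm.aestronglyMeasurable B
    (Eventually.of_forall fun x => by simpa only [Real.norm_eq_abs] using hφb x)

omit [TopologicalSpace X] [BorelSpace X] in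
/-- For `ρ ≤ σ`, the difference of the `ρ`-integrals of two `σ`-integrable functions is bounded
by the `σ`-integral of the absolute difference. [folklore] -/
private lemma abs_integral_sub_integral_le_integral_abs_sub {ρ σ : Measure X} (hρσ : ρ ≤ σ)
    {φ g : X → ℝ} (hφi : Integrable φ σ) (hgi : Integrable g σ) :
    |∫ x, φ x ∂ρ - ∫ x, g x ∂ρ| ≤ ∫ x, |φ x - g x| ∂σ := by
  rw [← integral_sub (hφi.mono_measure hρσ) (hgi.mono_measure hρσ)]
  calc |∫ x, φ x - g x ∂ρ| ≤ ∫ x, |φ x - g x| ∂ρ := abs_integral_le_integral_abs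
    _ ≤ ∫ x, |φ x - g x| ∂σ :=
      integral_mono_measure hρσ (Eventually.of_forall fun x => abs_nonneg _) (hφi.sub hgi).abs

/-- Clipping a real number to `[-1, 1]` does not increase its distance to a point of `[-1, 1]`.
[folklore] -/
private lemma abs_sub_clip_le {a b : ℝ} (ha : |a| ≤ 1) :
    |a - max (-1) (min 1 b)| ≤ |a - b| := by
  obtain ⟨ha₁, ha₂⟩ := abs_le.1 ha
  rcases le_total b 1 with hb | hb
  · rw [min_eq_right hb]
    rcases le_total (-1) b with hb' | hb'
    · rw [max_eq_right hb']
    · rw [max_eq_left hb', abs_of_nonneg (by linarith), abs_of_nonneg (by linarith)]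
      linarith
  · rw [min_eq_left hb, max_eq_right (by norm_num), abs_of_nonpos (by linarith),
      abs_of_nonpos (by linarith)]
    linarith

/-- **Extension of integral bounds to bounded measurable integrands.**  Let `μ`, `ν` be finite
Borel measures on a normal pseudo-metrizable space and assume `|∫ g dμ - ∫ g dν| ≤ C` for all
continuous `g` with `|g| ≤ 1`.  Then `|∫ φ dμ - ∫ φ dν| ≤ C` for every measurable `φ` with
`|φ| ≤ 1`.  Proof: approximate `φ` in `L¹(μ + ν)` by bounded continuous functions (density of
`C_b` in `L¹` of a weakly regular finite measure) and clip the approximants to `[-1, 1]`.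
[folklore] -/
theorem abs_integral_sub_integral_le_of_forall_continuous [NormalSpace X]
    [PseudoMetrizableSpace X]
    (μ ν : Measure X) [IsFiniteMeasure μ] [IsFiniteMeasure ν] {C : ℝ}
    (hC : ∀ g : X → ℝ, Continuous g → (∀ x, |g x| ≤ 1) → |∫ x, g x ∂μ - ∫ x, g x ∂ν| ≤ C)
    {φ : X → ℝ} (hφm : Measurable φ) (hφb : ∀ x, |φ x| ≤ 1) :
    |∫ x, φ x ∂μ - ∫ x, φ x ∂ν| ≤ C := by
  refine le_of_forall_pos_le_add fun ε hε => ?_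
  have hφi := integrable_of_abs_le hφm hφb
  -- approximate `φ` in `L¹(μ + ν)` by a bounded continuous function `g`
  obtain ⟨g, hg, hgi⟩ :=
    (hφi (μ + ν)).exists_boundedContinuous_integral_sub_le (half_pos hε)
  -- clip `g` to `[-1, 1]`: the result `g'` is an admissible test function which is pointwise
  -- at least as close to `φ` as `g`
  obtain ⟨g', hg'c, hg'b, hpt⟩ : ∃ g' : X → ℝ, Continuous g' ∧ (∀ x, |g' x| ≤ 1) ∧
      ∀ x, |φ x - g' x| ≤ |φ x - g x| :=
    ⟨fun x => max (-1) (min 1 (g x)), continuous_const.max (continuous_const.min g.continuous),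
      fun x => abs_le.2 ⟨le_max_left _ _, max_le (by norm_num) (min_le_left _ _)⟩,
      fun x => abs_sub_clip_le (hφb x)⟩
  have hg'i := integrable_of_abs_le hg'c.measurable hg'b
  have hclose : ∫ x, |φ x - g' x| ∂(μ + ν) ≤ ε / 2 := by
    refine le_trans (integral_mono ((hφi _).sub (hg'i _)).abs ((hφi _).sub hgi).norm
      fun x => ?_) hg
    change |φ x - g' x| ≤ ‖φ x - g x‖
    rw [Real.norm_eq_abs]
    exact hpt x
  have h₁ : |∫ x, φ x ∂μ - ∫ x, g' x ∂μ| ≤ ε / 2 :=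
    (abs_integral_sub_integral_le_integral_abs_sub (Measure.le_add_right le_rfl) (hφi _)
      (hg'i _)).trans hclose
  have h₂ : |∫ x, φ x ∂ν - ∫ x, g' x ∂ν| ≤ ε / 2 :=
    (abs_integral_sub_integral_le_integral_abs_sub (Measure.le_add_left le_rfl) (hφi _)
      (hg'i _)).trans hclose
  have h₃ := hC g' hg'c hg'b
  rw [abs_le] at h₁ h₂ h₃ ⊢
  constructor <;> linarith [h₁.1, h₁.2, h₂.1, h₂.2, h₃.1, h₃.2]

/-- **Scaled form.**  Under the hypothesis of
`abs_integral_sub_integral_le_of_forall_continuous` (a bound `C` on `|∫ g dμ - ∫ g dν|` over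
continuous `g` with `|g| ≤ 1`), every measurable `φ` with `|φ| ≤ B`, `0 ≤ B`, satisfies
`|∫ φ dμ - ∫ φ dν| ≤ C * B` (apply the unscaled form to `φ / B`; the case `B = 0` forces
`φ = 0`). [folklore] -/
theorem abs_integral_sub_integral_le_mul_of_forall_continuous [NormalSpace X]
    [PseudoMetrizableSpace X]
    (μ ν : Measure X) [IsFiniteMeasure μ] [IsFiniteMeasure ν] {C : ℝ}
    (hC : ∀ g : X → ℝ, Continuous g → (∀ x, |g x| ≤ 1) → |∫ x, g x ∂μ - ∫ x, g x ∂ν| ≤ C)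
    {φ : X → ℝ} (hφm : Measurable φ) {B : ℝ} (hB : 0 ≤ B) (hφb : ∀ x, |φ x| ≤ B) :
    |∫ x, φ x ∂μ - ∫ x, φ x ∂ν| ≤ C * B := by
  rcases hB.eq_or_lt with rfl | hBpos
  · obtain rfl : φ = fun _ => 0 := funext fun x => abs_nonpos_iff.1 (hφb x)
    simp
  · have h := abs_integral_sub_integral_le_of_forall_continuous μ ν hC (hφm.div_const B)
      (φ := fun x => φ x / B) fun x => by
        rw [abs_div, abs_of_pos hBpos, div_le_one hBpos]
        exact hφb x
    rwa [integral_div, integral_div, ← sub_div, abs_div, abs_of_pos hBpos,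
      div_le_iff₀ hBpos] at h

/-- **Measures of sets.**  Under the hypothesis of
`abs_integral_sub_integral_le_of_forall_continuous` and `μ univ = ν univ`, every measurable set
`S` satisfies `|μ.real S - ν.real S| ≤ C / 2`: test against `φ = 1_S - 1/2`, which is measurable
with `|φ| ≤ 1/2`, and note `∫ φ dμ - ∫ φ dν = μ S - ν S` because the total masses agree.
[folklore] -/
theorem abs_measureReal_sub_measureReal_le_of_forall_continuous [NormalSpace X]
    [PseudoMetrizableSpace X]
    (μ ν : Measure X) [IsFiniteMeasure μ] [IsFiniteMeasure ν] {C : ℝ}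
    (hC : ∀ g : X → ℝ, Continuous g → (∀ x, |g x| ≤ 1) → |∫ x, g x ∂μ - ∫ x, g x ∂ν| ≤ C)
    (hμν : μ univ = ν univ) {S : Set X} (hS : MeasurableSet S) :
    |μ.real S - ν.real S| ≤ C / 2 := by
  have hφm : Measurable fun x => S.indicator (1 : X → ℝ) x - 1 / 2 :=
    (measurable_one.indicator hS).sub_const _
  have hφb : ∀ x, |S.indicator (1 : X → ℝ) x - 1 / 2| ≤ 1 / 2 := fun x => by
    by_cases hx : x ∈ S
    · rw [indicator_of_mem hx, Pi.one_apply, abs_le]; constructor <;> norm_num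
    · rw [indicator_of_notMem hx, zero_sub, abs_neg, abs_of_pos one_half_pos]
  have h := abs_integral_sub_integral_le_mul_of_forall_continuous μ ν hC hφm
    one_half_pos.le hφb
  have hind : ∀ (ρ : Measure X) [IsFiniteMeasure ρ], Integrable (S.indicator (1 : X → ℝ)) ρ :=
    fun ρ _ => (integrable_const (1 : ℝ)).indicator hS
  have huniv : μ.real univ = ν.real univ := by rw [measureReal_def, measureReal_def, hμν]
  rw [integral_sub (hind μ) (integrable_const _), integral_sub (hind ν) (integrable_const _),
    integral_indicator_one hS, integral_indicator_one hS, integral_const, integral_const,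
    huniv, sub_sub_sub_cancel_right] at h
  linarith

end Literature.MeasureTheory.Integral
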